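import Literature.NumberTheory.QuadraticForms.PadicHilbertSymbolUnits
import HarnessLib

/-!
# The `2`-adic Hilbert symbols `(u, 2ᵉ w)_2` of a unit constrained by its cyclotomic residue: Liu's three dyadic cases

Topic `NumberTheory/QuadraticForms`; namespace `Literature.NumberTheory.QuadraticForms` (sequel of `PadicHilbertSymbolUnits.lean`).
KERNEL mathematics only: theorems over Mathlib's `ℚ_[2]`, no definition, no named fact, no `sorry`.

From Serre's formula `(2ᵅ u, 2ᵝ v)_2 = (-1)^{ε(u)ε(v) + α ω(v) + β ω(u)}` ([Serre1973] Ch. III §1.2 Thm 1; tree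
`hilbertSymbol_padic_two_pow_mul_unit`) with `α = 0`: for `2`-adic units `u, w` with residues `m, m' (mod 8)` and `e : ℕ`,

* `hilbertSymbol_padic_two_unit_pow_mul_unit` — `(u, 2ᵉ w)_2 = (-1)^{ε(m)ε(m')} · χ₈(m)ᵉ` (`epsSign m m' * χ₈ m ^ e`);
* **`hilbertSymbol_padic_two_unit_pow_mul_unit_eq_one_of_cases`** — `(u, 2ᵉ w)_2 = 1` as soon as the residue `m` of `u` satisfies the
  condition attached to the square class of `c = (-1)^{ε(m')} 2ᵉ`: `χ₈(m) = 1` if `c ∼ 2` (`e` odd, `m' ≡ 1 (4)`), `χ₄(m) = 1` if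
  `c ∼ -1` (`e` even, `m' ≡ 3 (4)`), `χ₈'(m) = 1` if `c ∼ -2` (`e` odd, `m' ≡ 3 (4)`), nothing if `c ∼ 1`.

This is the `ℚ₂`-side of the DYADIC case of [Liu2021, Thm. 4.18 (3)] (proof l. 2281–2289: «`M_{E/F} = ℚ(√−1)` … `U_{E/F} = 1 + 4ℤ₂`»,
«`ℚ(√2)` … `±1 + 8ℤ₂`», «`ℚ(√−2)` … `±1 + 2 + 8ℤ₂`»): with `u = χ_{cyc,2}(σ)`, `m̄ = χ̄₈(σ)`, the three hypotheses are exactly what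
`σ ∈ Aut(ℂ/M_μ)` fixing `√c ∈ M_μ` gives (tree `Thm418CyclotomicSquareRoots`: `apply_eq_self_iff_of_sq_eq_two/_neg_one/_neg_two`), and
`(κ, θ)_𝔭 = (κ, N θ)_{ℚ₂} = (u, 2ᵉ w)_2` by the projection formula (`HilbertSymbolNormCompatAtTwo`).  Cell hodgecm-mathlib, row III-11c
(`CyclotomicUnitIsLocalNormDyadic`), hand of A-p11's dyadic closer; HC_CM is proved only modulo the printed citations until rung 0 closes.

## References
* [Serre1973] J.-P. Serre, *A Course in Arithmetic*, GTM 7 (1973), Ch. III §1.2 Thm 1 (p. 20); Ch. II §3.3.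
* [Liu2021] Y. Liu, Camb. J. Math. 9 (2021) = arXiv:2102.11518, Thm. 4.18 (3), proof l. 2281–2289.
-/

noncomputable section

open ZMod

namespace Literature.NumberTheory.QuadraticForms

/-- a `2`-adic unit has ODD residue mod `8`. [cite: Serre1973, Ch. II §3.3] -/
theorem odd_of_toZModPow_three_eq {w : ℤ_[2]ˣ} {n : ℤ} (hn : PadicInt.toZModPow 3 (w : ℤ_[2]) = (n : ZMod (2 ^ 3))) : Odd n := by
  rw [← Int.not_even_iff_odd, even_iff_two_dvd]
  intro hdvd
  have h8 : IsUnit ((n : ZMod (2 ^ 3))) := by rw [← hn]; exact w.isUnit.map _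
  obtain ⟨k, rfl⟩ := hdvd
  have h2 : IsUnit ((2 : ℤ) : ZMod (2 ^ 3)) := by
    push_cast at h8
    exact isUnit_of_mul_isUnit_left h8
  have : IsUnit ((2 : ℕ) : ZMod (2 ^ 3)) := by exact_mod_cast h2
  rw [ZMod.isUnit_iff_coprime] at this
  norm_num at this

/-- `χ₄` of an odd integer is `1` or `-1`. [cite: Serre1973, Ch. II §3.3] -/
theorem χ₄_int_eq_one_or_eq_neg_one_of_odd {n : ℤ} (hn : Odd n) : χ₄ (n : ZMod 4) = 1 ∨ χ₄ (n : ZMod 4) = -1 := by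
  rw [χ₄_int_eq_if_mod_four, if_neg (by rw [Int.odd_iff] at hn; omega)]
  split_ifs <;> simp

/-- `χ₈` of an odd integer is `1` or `-1`. [cite: Serre1973, Ch. II §3.3] -/
theorem χ₈_int_eq_one_or_eq_neg_one_of_odd {n : ℤ} (hn : Odd n) : χ₈ (n : ZMod 8) = 1 ∨ χ₈ (n : ZMod 8) = -1 := by
  rw [χ₈_int_eq_if_mod_eight, if_neg (by rw [Int.odd_iff] at hn; omega)]
  split_ifs <;> simp

/-- `χ₈(m)² = 1` for odd `m`. [cite: Serre1973, Ch. II §3.3] -/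
theorem χ₈_int_sq_of_odd {n : ℤ} (hn : Odd n) : χ₈ (n : ZMod 8) ^ 2 = 1 := by
  rcases χ₈_int_eq_one_or_eq_neg_one_of_odd hn with h | h <;> rw [h] <;> norm_num

/-- **`(u, 2ᵉ w)_2 = (-1)^{ε(m)ε(m')} χ₈(m)ᵉ`** for `2`-adic units `u ≡ m`, `w ≡ m' (mod 8)` (Serre's Thm 1 with `α = 0`, `β = e`).
[cite: Serre1973, Ch. III §1.2 Thm 1] -/
theorem hilbertSymbol_padic_two_unit_pow_mul_unit (u w : ℤ_[2]ˣ) {m m' : ℤ}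
    (hm : PadicInt.toZModPow 3 (u : ℤ_[2]) = (m : ZMod (2 ^ 3)))
    (hm' : PadicInt.toZModPow 3 (w : ℤ_[2]) = (m' : ZMod (2 ^ 3))) (e : ℕ) :
    hilbertSymbol ℚ_[2] ((u : ℤ_[2]) : ℚ_[2]) ((2 : ℚ_[2]) ^ e * ((w : ℤ_[2]) : ℚ_[2])) =
      epsSign m m' * χ₈ (m : ZMod 8) ^ e := by
  have h := hilbertSymbol_padic_two_pow_mul_unit u w hm hm' 0 e
  rw [pow_zero, one_mul, pow_zero, mul_one] at h
  exact h

/-- **Liu's three dyadic cases** ([Liu2021] l. 2283/2285/2287 + the square case): for `2`-adic units `u ≡ m`, `w ≡ m' (mod 8)` and `e : ℕ`,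
`(u, 2ᵉ w)_2 = 1` provided: `e` odd and `m' ≡ 1 (4)` ⇒ `χ₈(m) = 1` («`U_{E/F} = ±1 + 8ℤ₂`», `c ∼ 2`); `e` even and `m' ≡ 3 (4)` ⇒
`χ₄(m) = 1` («`1 + 4ℤ₂`», `c ∼ -1`); `e` odd and `m' ≡ 3 (4)` ⇒ `χ₈'(m) = 1` («`±1 + 2 + 8ℤ₂`», `c ∼ -2`).
[cite: Liu2021, Thm. 4.18 (3), proof l. 2281–2289] [cite: Serre1973, Ch. III §1.2 Thm 1] -/
theorem hilbertSymbol_padic_two_unit_pow_mul_unit_eq_one_of_cases (u w : ℤ_[2]ˣ) {m m' : ℤ}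
    (hm : PadicInt.toZModPow 3 (u : ℤ_[2]) = (m : ZMod (2 ^ 3)))
    (hm' : PadicInt.toZModPow 3 (w : ℤ_[2]) = (m' : ZMod (2 ^ 3))) (e : ℕ)
    (h₁ : Odd e → χ₄ (m' : ZMod 4) = 1 → χ₈ (m : ZMod 8) = 1)
    (h₂ : Even e → χ₄ (m' : ZMod 4) = -1 → χ₄ (m : ZMod 4) = 1)
    (h₃ : Odd e → χ₄ (m' : ZMod 4) = -1 → χ₈' (m : ZMod 8) = 1) :
    hilbertSymbol ℚ_[2] ((u : ℤ_[2]) : ℚ_[2]) ((2 : ℚ_[2]) ^ e * ((w : ℤ_[2]) : ℚ_[2])) = 1 := by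
  rw [hilbertSymbol_padic_two_unit_pow_mul_unit u w hm hm' e]
  have hmo : Odd m := odd_of_toZModPow_three_eq hm
  have hm'o : Odd m' := odd_of_toZModPow_three_eq hm'
  rcases Nat.even_or_odd e with he | he
  · -- `e` even: `χ₈(m)ᵉ = 1`, and `ε(m)ε(m') = 0` by `h₂`
    have h8 : χ₈ (m : ZMod 8) ^ e = 1 := by
      obtain ⟨k, rfl⟩ := he
      rw [← two_mul, pow_mul, χ₈_int_sq_of_odd hmo, one_pow]
    rw [h8, mul_one]
    unfold epsSign
    rw [if_neg]
    rintro ⟨hmm, hww⟩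
    have h1 := h₂ he hww
    rw [h1] at hmm
    exact absurd hmm (by decide)
  · -- `e` odd: `χ₈(m)ᵉ = χ₈(m)`
    have h8 : χ₈ (m : ZMod 8) ^ e = χ₈ (m : ZMod 8) := by
      obtain ⟨k, rfl⟩ := he
      rw [pow_succ, pow_mul, χ₈_int_sq_of_odd hmo, one_pow, one_mul]
    rw [h8]
    rcases χ₄_int_eq_one_or_eq_neg_one_of_odd hm'o with hw | hw
    · -- `m' ≡ 1 (4)`: `epsSign = 1` and `χ₈(m) = 1`
      rw [h₁ he hw, mul_one]
      unfold epsSign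
      rw [if_neg]
      rintro ⟨-, hww⟩
      rw [hw] at hww
      exact absurd hww (by decide)
    · -- `m' ≡ 3 (4)`: `epsSign m m' = χ₄(m)`, so the value is `χ₄(m) χ₈(m) = χ₈'(m) = 1`
      have hε : (epsSign m m' : ℤ) = χ₄ (m : ZMod 4) := by
        unfold epsSign
        rcases χ₄_int_eq_one_or_eq_neg_one_of_odd hmo with hu | hu
        · rw [hu, if_neg]
          rintro ⟨huu, -⟩
          exact absurd huu (by decide)
        · rw [hu, if_pos ⟨rfl, hw⟩]
      rw [hε, ← χ₈'_int_eq_χ₄_mul_χ₈]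
      exact h₃ he hw

end Literature.NumberTheory.QuadraticForms

end
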